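import Summits.CriticalPhenomena.PercolationContinuityZ3.Theorems.PercNearOneGluingNoHeavyQuantFarSunCertElevenFourC
import HarnessLib

/-!
# FAR beyond trees: **`HairyCycle.SunFAR 11 4`** — an exact WINDOW-TYPED reached-set-level two-copy certificate for the sun graph with `K = 11` hairs at layer `j = 4` (shared-products Kronecker check, sharded) — shard file 4/4 (`l ∈ {11}`)

builds on p205010 (kernel theorem, internal audit signed; external expert review pending)

Support file (`--supports stmt-CriticalPhenomena-4575`), seat `prim-cert-1` (gen 33; certificate from gen 30 kit LPs; pipeline gen 26/28/30/32); memos `prim-cert-1/FROM-prim-cert-1-g26-CONFIG-CERTS.md`, `prim-cert-1/FROM-prim-cert-1-g28-TOP-LAYERS.md`.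
Shard 4 of 4 of the Kronecker check of the `(11,4)` certificate (`PercNearOneGluingNoHeavyQuantFarSunCertElevenFour`): prefix lengths `l ∈ {11}`
(936 blocks; each shard file stays under the farm's elaboration budget).  COMPUTATIONAL (`native_decide`).  Assembles **`HairyCycle.sunFAR_eleven_four : SunFAR 11 4`**.
[cite: KozmaNitzan2024, Lemma 2 (p. 6), Conjecture 3 (p. 15)] (context: the lower-tail family; FAR is this programme's statement).
-/

namespace Summit.CriticalPhenomena.PercolationContinuityZ3.Theorems.HairyCycle

namespace TK


/-- Core-inequality check of the `(11, 4)` certificate, shard `l ∈ {11}` (936 blocks), base `2^27` (computational;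
one `native_decide`, so the record banks are built once). [this work] -/
theorem cK114_s4 : ([11].all fun l => kronL2 11 27 (mkSBanks 11 4 27 (mkNTabs 11 am114 bm114)) l) = true := by
  native_decide

end TK

/-- **FAR at layer `4` on the sun graph with `11` hairs, all weights: `SunFAR 11 4`** (exact WINDOW-TYPED reached-set-level two-copy certificate (kit j196393, window-typed class wt99 (630 classes, 518 a + 112 b nonzero), exact denominator 1), checked by the sharded shared-products Kronecker checker). [this work] -/
theorem sunFAR_eleven_four : SunFAR 11 4 := by
  refine TK.sunFAR_of_kronL2' (s := 27) (by norm_num) TK.am114 TK.bm114 (TK.prefixInv_rl 11 TK.tabA114 TK.tabB114) TK.cN114 fun l hl => ?_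
  have h1 := List.all_eq_true.1 TK.cK114_s1
  have h2 := List.all_eq_true.1 TK.cK114_s2
  have h3 := List.all_eq_true.1 TK.cK114_s3
  have h4 := List.all_eq_true.1 TK.cK114_s4
  interval_cases l
  · exact h1 0 (by simp)
  · exact h1 1 (by simp)
  · exact h1 2 (by simp)
  · exact h1 3 (by simp)
  · exact h1 4 (by simp)
  · exact h1 5 (by simp)
  · exact h2 6 (by simp)
  · exact h2 7 (by simp)
  · exact h2 8 (by simp)
  · exact h3 9 (by simp)
  · exact h3 10 (by simp)
  · exact h4 11 (by simp)

end Summit.CriticalPhenomena.PercolationContinuityZ3.Theorems.HairyCycle
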